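import Literature.NumberTheory.Rogawski1990.ArchHCSpaceGInnerTransportRiders      -- ★ (6): `orbFamGExt`, slot-sign bookkeeping, `mem_splitChartPlaces_quasiSplitWeights` (via (3))
import Literature.NumberTheory.Rogawski1990.ArchStableSumGClassSum                 -- ★ (2) PART 3: `stableSumG_eq_archRG_mul_sum`
import Literature.NumberTheory.Rogawski1990.ArchJumpConstInnerTransport            -- ★ (5) FILE A: `isIndefiniteAt_of_mem_splitChartPlaces`
import HarnessLib

/-!
# READ-INNER, part 1 (N8-INNER brick (11) «JUNCTION», LH3-p03 (g7)): the chart-sum identity and the multiplicity of the inner twist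

Topic `NumberTheory/Rogawski1990`; namespace `Literature.NumberTheory.Rogawski1990`.  THEOREMS ONLY.  Cell `pub/hodgecm-mathlib`, crux H413
(`stmt-HodgeConjecture-24833`), road «N8-INNER» (row 2 `stub_N8`), brick (11) «JUNCTION», LAYER 2 (READ-INNER), part 1 of 3: the two pieces of
pure bookkeeping between SURJ-G's output currency and READ-G's input currency.

* §1 **`sum_chartOrbG_eq_of_stableSumG_eq`**: on an admissible chart `S ⊆ splitChartPlaces L α` at a regular point `c ∈ RegG S`, the STABLE
  matching `stableSumG (orbFamGExt L β νβ f) S c = stableSumG (κ • orbFamGExt L α ν′ a′) S c` (what (12) SURJ-G ASM delivers) is the equality of the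
  PLAIN partner sums of the chart functionals `Σ_ρ chartOrbG L β νβ S f (ρ·c) = κ · Σ_ρ chartOrbG L α ν′ S a′ (ρ·c)` (what ★ READ-G reads) —
  ★ `stableSumG_eq_archRG_mul_sum` on both sides and `archRG S c ≠ 0`.
* §2 **`partnerWeight_eq_quasiSplit_mul`**: the READ-G weights of the two frames differ by the place-product of the class-count ratios:
  `partnerWeight L α S = partnerWeight L β S · ∏_{w ∉ S, w definite for α} 3⁻¹` (`|S₃∕W| = 1` class on `U(3)` against `3` on `U(2,1)`, read as `6⁻¹`
  vs `2⁻¹`); on an admissible chart the exponent is the number of definite places of `α` — the constant `κ = 3^{−#def}` of FORWARD's rescaling (ref5 R-726).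

References: Rogawski 1990 §4.1 (4.1.1), §4.3 (4.3.1), §14.2 (14.2.1); Shelstad 1979 §4 Lemma 4.2.
-/

set_option autoImplicit false

noncomputable section

open MeasureTheory MeasureTheory.Measure NumberField NumberField.InfinitePlace Matrix Complex Filter Topology Finset
open scoped MatrixGroups Matrix ContDiff Classical
open Literature.NumberTheory.Automorphic Literature.NumberTheory.Automorphic.UnitaryGroup Literature.NumberTheory.Automorphic.ArchCartan
open Literature.NumberTheory.GaloisRepresentations

namespace Literature.NumberTheory.Rogawski1990

/-! ## §1 The chart-sum identity -/

section Sums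

variable (L : Type) [Field L] [NumberField L] [IsCMField L] (α : Fin 3 → L)
  [MeasurableSpace ↥(arch (↥(maximalRealSubfield L)) L (IsCMField.complexConj L) 3 (Matrix.diagonal α))]
  [BorelSpace ↥(arch (↥(maximalRealSubfield L)) L (IsCMField.complexConj L) 3 (Matrix.diagonal α))]
  (ν' : Measure ↥(arch (↥(maximalRealSubfield L)) L (IsCMField.complexConj L) 3 (Matrix.diagonal α)))
  [ν'.IsHaarMeasure] [ν'.IsMulRightInvariant]

/-- **The stable sum of the wall-extended ordinary family is `R′ ·` the plain partner sum of the chart functional**, on an admissible chart at a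
regular point (★ `stableSumG_eq_archRG_mul_sum` + ★ `orbFamGExt_of_mem_regG_of_admissible` at the slot-permuted points, which stay regular).
[cite: Rogawski1990, §4.1 (4.1.1) p. 39] [cite: Shelstad1979, Lemma 4.2 (p. 23)] -/
theorem stableSumG_orbFamGExt_eq_archRG_mul_sum {S : Finset {w : InfinitePlace L // IsComplex w}}
    (hS : ∀ w, w ∈ S → w ∈ splitChartPlaces L α) {c : {w : InfinitePlace L // IsComplex w} → Fin 3 → ℝ} (hc : c ∈ RegG S)
    (a' : ↥(arch (↥(maximalRealSubfield L)) L (IsCMField.complexConj L) 3 (Matrix.diagonal α)) → ℂ) :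
    stableSumG (orbFamGExt L α ν' a') S c = archRG S c * ∑ ρ ∈ partnerPerms S, chartOrbG L α ν' S a' (slotPerm ρ c) :=
  stableSumG_eq_archRG_mul_sum fun _ hρ =>
    orbFamGExt_of_mem_regG_of_admissible L α ν' a' S hS ((slotPerm_mem_regG_iff hρ c).2 hc)

/-- The same for a constant multiple of the family. [cite: Rogawski1990, §4.1 (4.1.1) p. 39] -/
theorem stableSumG_const_mul_orbFamGExt_eq_archRG_mul_sum (κ : ℂ) {S : Finset {w : InfinitePlace L // IsComplex w}}
    (hS : ∀ w, w ∈ S → w ∈ splitChartPlaces L α) {c : {w : InfinitePlace L // IsComplex w} → Fin 3 → ℝ} (hc : c ∈ RegG S)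
    (a' : ↥(arch (↥(maximalRealSubfield L)) L (IsCMField.complexConj L) 3 (Matrix.diagonal α)) → ℂ) :
    stableSumG (fun S' c' => κ * orbFamGExt L α ν' a' S' c') S c =
      archRG S c * (κ * ∑ ρ ∈ partnerPerms S, chartOrbG L α ν' S a' (slotPerm ρ c)) := by
  rw [Finset.mul_sum]
  refine stableSumG_eq_archRG_mul_sum (Φ := fun c' => κ * chartOrbG L α ν' S a' c') fun ρ hρ => ?_
  show κ * orbFamGExt L α ν' a' S (slotPerm ρ c) = archRG S (slotPerm ρ c) * (κ * chartOrbG L α ν' S a' (slotPerm ρ c))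
  rw [orbFamGExt_of_mem_regG_of_admissible L α ν' a' S hS ((slotPerm_mem_regG_iff hρ c).2 hc)]
  ring

variable
  [MeasurableSpace ↥(arch (↥(maximalRealSubfield L)) L (IsCMField.complexConj L) 3 (Matrix.diagonal ![(2 : L)⁻¹, 1, -(2 : L)⁻¹]))]
  [BorelSpace ↥(arch (↥(maximalRealSubfield L)) L (IsCMField.complexConj L) 3 (Matrix.diagonal ![(2 : L)⁻¹, 1, -(2 : L)⁻¹]))]
  (νβ : Measure ↥(arch (↥(maximalRealSubfield L)) L (IsCMField.complexConj L) 3 (Matrix.diagonal ![(2 : L)⁻¹, 1, -(2 : L)⁻¹])))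
  [νβ.IsHaarMeasure] [νβ.IsMulRightInvariant]

/-- **THE CHART-SUM IDENTITY**: at a regular point of a chart admissible for `α`, the STABLE matching of the `β`-family of `f` with
`κ • orbFamGExt L α ν′ a′` is the equality of the PLAIN partner sums of the chart functionals, `Σ_ρ chartOrbG_β f (ρ·c) = κ · Σ_ρ chartOrbG_α a′ (ρ·c)`
(every chart is admissible for the quasi-split frame `β`; `archRG S c ≠ 0` on `RegG S`). [cite: Rogawski1990, §4.1 (4.1.1) p. 39; §14.2 (14.2.1) p. 232]
[cite: Shelstad1979, Lemma 4.2 (p. 23)] -/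
theorem sum_chartOrbG_eq_of_stableSumG_eq (κ : ℂ) {S : Finset {w : InfinitePlace L // IsComplex w}}
    (hS : ∀ w, w ∈ S → w ∈ splitChartPlaces L α) {c : {w : InfinitePlace L // IsComplex w} → Fin 3 → ℝ} (hc : c ∈ RegG S)
    {a' : ↥(arch (↥(maximalRealSubfield L)) L (IsCMField.complexConj L) 3 (Matrix.diagonal α)) → ℂ}
    {f : ↥(arch (↥(maximalRealSubfield L)) L (IsCMField.complexConj L) 3 (Matrix.diagonal ![(2 : L)⁻¹, 1, -(2 : L)⁻¹])) → ℂ}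
    (h : stableSumG (orbFamGExt L ![(2 : L)⁻¹, 1, -(2 : L)⁻¹] νβ f) S c = stableSumG (fun S' c' => κ * orbFamGExt L α ν' a' S' c') S c) :
    ∑ ρ ∈ partnerPerms S, chartOrbG L ![(2 : L)⁻¹, 1, -(2 : L)⁻¹] νβ S f (slotPerm ρ c) =
      κ * ∑ ρ ∈ partnerPerms S, chartOrbG L α ν' S a' (slotPerm ρ c) := by
  rw [stableSumG_orbFamGExt_eq_archRG_mul_sum L _ νβ (fun w _ => mem_splitChartPlaces_quasiSplitWeights L w) hc f,
    stableSumG_const_mul_orbFamGExt_eq_archRG_mul_sum L α ν' κ hS hc a'] at h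
  exact mul_left_cancel₀ (archRG_ne_zero_of_mem_regG hc) h

end Sums

/-! ## §2 The multiplicity: the READ-G weights of the two frames -/

section Weights

variable (L : Type) [Field L] [NumberField L] [IsCMField L] (α : Fin 3 → L)

omit [IsCMField L] in
/-- **Every place is indefinite for the quasi-split frame `β`.** [cite: Rogawski1990, §14.1 p. 232] -/
theorem isIndefiniteAt_slotSign_quasiSplitWeights (w : {w : InfinitePlace L // IsComplex w}) :
    IsIndefiniteAt (slotSign L ![(2 : L)⁻¹, 1, -(2 : L)⁻¹]) w :=
  isIndefiniteAt_of_mem_splitChartPlaces L _ (quasiSplitWeights_ne_zero L) (mem_splitChartPlaces_quasiSplitWeights L w)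

omit [IsCMField L] in
/-- The READ-G weight of the quasi-split frame: `2⁻¹` at every compact place. [cite: Rogawski1990, §4.3 (4.3.1) p. 43] -/
theorem partnerWeight_quasiSplitWeights (S : Finset {w : InfinitePlace L // IsComplex w}) :
    partnerWeight L ![(2 : L)⁻¹, 1, -(2 : L)⁻¹] S = ∏ _w ∈ Finset.univ \ S, (2 : ℂ)⁻¹ := by
  unfold partnerWeight
  exact Finset.prod_congr rfl fun w _ => by rw [if_pos (isIndefiniteAt_slotSign_quasiSplitWeights L w)]

omit [NumberField L] [IsCMField L] in
/-- **THE MULTIPLICITY OF THE INNER TWIST**: the READ-G weight of the frame `α` is the weight of the quasi-split frame times `3⁻¹` for every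
compact place of the chart that is DEFINITE for `α` (there the stable class of a regular chart point is ONE `U(3)`-class, `|partner fibre| = 6`,
against THREE `U(2,1)`-classes, fibre `2`). [cite: Rogawski1990, §4.3 (4.3.1) p. 43; §14.2 (14.2.1) p. 232] [cite: Shelstad1979, Lemma 4.2 (p. 23)] -/
theorem partnerWeight_eq_quasiSplit_mul [NumberField L] (S : Finset {w : InfinitePlace L // IsComplex w}) :
    partnerWeight L α S =
      partnerWeight L ![(2 : L)⁻¹, 1, -(2 : L)⁻¹] S *
        ∏ _w ∈ (Finset.univ \ S).filter (fun w => ¬ IsIndefiniteAt (slotSign L α) w), (3 : ℂ)⁻¹ := by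
  rw [partnerWeight_quasiSplitWeights, Finset.prod_filter, ← Finset.prod_mul_distrib]
  unfold partnerWeight
  refine Finset.prod_congr rfl fun w _ => ?_
  by_cases h : IsIndefiniteAt (slotSign L α) w
  · rw [if_pos h, if_neg (not_not.2 h), mul_one]
  · rw [if_neg h, if_pos h]
    norm_num

omit [NumberField L] [IsCMField L] in
/-- **On an admissible chart the multiplicity is the GLOBAL constant `κ = ∏_{w definite} 3⁻¹`**: every definite place of `α` is a compact place of
every admissible chart (`S ⊆ splitChartPlaces L α`, and split-chart places are indefinite). [cite: Rogawski1990, §14.2 (14.2.1) p. 232; §3.6 p. 31] -/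
theorem partnerWeight_eq_quasiSplit_mul_of_admissible [NumberField L] (hα : ∀ i, α i ≠ 0) {S : Finset {w : InfinitePlace L // IsComplex w}}
    (hS : ∀ w, w ∈ S → w ∈ splitChartPlaces L α) :
    partnerWeight L α S =
      partnerWeight L ![(2 : L)⁻¹, 1, -(2 : L)⁻¹] S *
        ∏ _w ∈ Finset.univ.filter (fun w => ¬ IsIndefiniteAt (slotSign L α) w), (3 : ℂ)⁻¹ := by
  rw [partnerWeight_eq_quasiSplit_mul]
  congr 1
  refine Finset.prod_congr ?_ fun _ _ => rfl
  ext w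
  simp only [Finset.mem_filter, Finset.mem_sdiff, Finset.mem_univ, true_and, and_iff_right_iff_imp]
  intro hw hwS
  exact hw (isIndefiniteAt_of_mem_splitChartPlaces L α hα (hS w hwS))

end Weights

end Literature.NumberTheory.Rogawski1990

end
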